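import Mathlib
import Summits.RiemannHypothesis.RiemannHypothesis.Theorems.IntegerScrewExitGreen
import HarnessLib

/-!
# Route `IntegerScrew` — the exit-death FLOW: divergence identity, energy, and the flow form of
# Cauchy–Schwarz (CONTINUUM-LIMIT §25.1 (b)–(d))

With `Γ = exitGamma R Q` (the Green function of the exit-death chain on the window `W = (Q, R]` of `Ω_R`,
`IntegerScrewExitGreen`), put the unnormalised harmonic weight `1/x` on `W` and the flow
`F(x → x/n) = (Γ(x)/x)·Λ(n)/log x` on the death edges (`n ∣ x`).  Then (25.1):

* `exitInflow R Q y = Σ_{n ≤ R/y} (Γ(yn)/(yn))·Λ(n)/log(yn)` — the flow INTO `y`; on `W` it equals `Γ(y)/y − 1/y`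
  (`exitInflow_eq_of_mem`, the Green recursion read backwards) and on `B = [1, Q]` it is the unnormalised EXIT
  MEASURE `ν_exit`;
* `sum_divisors_reindex` — `Σ_{x ≤ R} Σ_{n ∣ x} h(x, n) = Σ_{y ≤ R} Σ_{n ≤ R/y} h(yn, n)`;
* **`exit_flow_divergence`** — `Σ_{x ≤ R} Σ_{n ∣ x} F(x → x/n)(g(x) − g(x/n)) = Σ_{Q<x≤R} g(x)/x − Σ_{b ≤ Q} ν_exit(b) g(b)`
  (`div F = σ_W − ν_exit`, unnormalised); with `g ≡ 1`: **`sum_exitInflow_eq`** (`ν_exit` has the mass of `W`);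
* **`exit_flow_cauchy_schwarz`** — the flow form of Cauchy–Schwarz (Thomson's principle for this flow):
  `(Σ_{Q<x≤R} g(x)/x − Σ_{b≤Q} ν_exit(b)g(b))² ≤ [Σ_{Q<x≤R} Γ(x)²/(x log x)] · D(g)`,
  `D(g) = Σ_{x ≤ R}(1/x)Σ_{n ∣ x}Λ(n)(g(x) − g(x/n))²` (the energy `Σ_e F²/c = Σ_W Γ²/(x log x)` uses
  `Σ_{n ∣ x}Λ(n) = log x`);
* **`exit_flow_cauchy_schwarz_explicit`** — combined with `sum_exitGamma_sq_div_le`: for `2 ≤ Q ≤ R` and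
  the pointwise Green bound `Γ(x) ≤ A log R/log x` on the window (`exitGamma_le`, or the sharp
  `IntegerScrewExitGreenSharp.exitGamma_le_sharp'`):
  `(Σ_{Q<x≤R} g(x)/x − Σ_{b≤Q} ν_exit(b)g(b))² ≤ A² log²R·(1/(2log²Q) − 1/(2log²R))·D(g)` —
  the `κ_F` half of THEOREM A as a kernel inequality on test functions.

RH-free, elementary.  Nothing in this file bears on the truth of RH.
References: CONTINUUM-LIMIT §25.1, §25.4–25.5 (rh-explicit A6-PIVOT); M. Suzuki, J. Lond. Math. Soc. (2) 108 (2023)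
1448–1487 [Suzuki2023] for the screw matrices this serves.
-/

noncomputable section

set_option linter.dupNamespace false -- D-0017: `Summit.<S>.<S>.…` is the designed namespace

namespace Summit.RiemannHypothesis.RiemannHypothesis.Theorems.IntegerScrew

open Finset Real
open ArithmeticFunction (vonMangoldt)

/-! ### The inflow and the exit measure -/

/-- The flow into `y`: `Σ_{n ≤ R/y} (Γ(yn)/(yn))·Λ(n)/log(yn)` (on the window this is `Γ(y)/y − 1/y`, on
`[1, Q]` it is the unnormalised exit measure `ν_exit(y)`).
[cite: Suzuki2023, §1 (the screw matrices S_M whose pivot/spectral theory this serves)] -/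
def exitInflow (R Q y : ℕ) : ℝ :=
  ∑ n ∈ Icc 1 (R / y), exitGamma R Q (y * n) / ((y * n : ℕ) : ℝ) * (vonMangoldt n / Real.log ((y * n : ℕ) : ℝ))

/-- On the window the inflow is the Green recursion read backwards: `inflow(y) = Γ(y)/y − 1/y`. -/
theorem exitInflow_eq_of_mem {R Q y : ℕ} (h : Q < y ∧ y ≤ R) :
    exitInflow R Q y = exitGamma R Q y / y - 1 / y := by
  have hy : 1 ≤ y := by omega
  have hy0 : (y : ℝ) ≠ 0 := by exact_mod_cast (show y ≠ 0 by omega)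
  have hRy : 1 ≤ R / y := Nat.div_pos h.2 (by omega)
  unfold exitInflow
  -- split off n = 1 (Λ(1) = 0) and use the recursion for n ≥ 2
  have hI : Icc 1 (R / y) = insert 1 (Icc 2 (R / y)) := by
    ext n; simp only [Finset.mem_insert, Finset.mem_Icc]; omega
  rw [hI, Finset.sum_insert (by simp), ArithmeticFunction.vonMangoldt_apply_one, zero_div, mul_zero, zero_add,
    exitGamma_eq h]
  rw [add_div, Finset.sum_div]
  have hterm : ∀ n ∈ Icc 2 (R / y),
      exitGamma R Q (y * n) / ((y * n : ℕ) : ℝ) * (vonMangoldt n / Real.log ((y * n : ℕ) : ℝ)) =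
        vonMangoldt n / n * (exitGamma R Q (y * n) / Real.log ((y * n : ℕ) : ℝ)) / y := by
    intro n hn
    have hn0 : (n : ℝ) ≠ 0 := by exact_mod_cast (show n ≠ 0 by have := (Finset.mem_Icc.1 hn).1; omega)
    push_cast
    field_simp
  rw [Finset.sum_congr rfl hterm]
  ring

/-! ### Reindexing divisor pairs -/

/-- `Σ_{j ≤ M, k ∣ j} G(j) = Σ_{n ≤ M/k} G(kn)` (private copy of `IntegerScrewParityGap.sum_Icc_filter_dvd_eq`). -/
private theorem sum_Icc_filter_dvd_eq_mul' {M k : ℕ} (hk : 1 ≤ k) (G : ℕ → ℝ) :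
    ∑ j ∈ (Icc 1 M).filter (fun j => k ∣ j), G j = ∑ n ∈ Icc 1 (M / k), G (k * n) := by
  have hk0 : k ≠ 0 := by omega
  have hset : (Icc 1 M).filter (fun j => k ∣ j) =
      (Icc 1 (M / k)).map ⟨fun n => k * n, mul_right_injective₀ hk0⟩ := by
    ext j
    simp only [mem_filter, mem_Icc, mem_map, Function.Embedding.coeFn_mk]
    constructor
    · rintro ⟨⟨h1, h2⟩, ⟨n, rfl⟩⟩
      refine ⟨n, ⟨?_, ?_⟩, rfl⟩
      · rcases Nat.eq_zero_or_pos n with h | h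
        · subst h; simp at h1
        · exact h
      · exact (Nat.le_div_iff_mul_le hk).2 (by rw [mul_comm]; exact h2)
    · rintro ⟨n, ⟨h1, h2⟩, rfl⟩
      refine ⟨⟨?_, ?_⟩, dvd_mul_right k n⟩
      · exact Nat.one_le_iff_ne_zero.2 (Nat.mul_ne_zero hk0 (by omega))
      · have := (Nat.le_div_iff_mul_le hk).1 h2
        rwa [mul_comm] at this
  rw [hset, sum_map]
  rfl

/-- `Σ_{x ≤ R} Σ_{n ∣ x} h(x, n) = Σ_{y ≤ R} Σ_{n ≤ R/y} h(yn, n)` (divisor pairs `x = y·n`). -/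
theorem sum_divisors_reindex (R : ℕ) (h : ℕ → ℕ → ℝ) :
    ∑ x ∈ Icc 1 R, ∑ n ∈ x.divisors, h x n = ∑ y ∈ Icc 1 R, ∑ n ∈ Icc 1 (R / y), h (y * n) n := by
  -- Step 1: x-sum over divisors n  →  n-sum over multiples x
  have h1 : ∑ x ∈ Icc 1 R, ∑ n ∈ x.divisors, h x n =
      ∑ n ∈ Icc 1 R, ∑ x ∈ (Icc 1 R).filter (fun x => n ∣ x), h x n := by
    refine Finset.sum_comm' ?_
    intro x n
    simp only [mem_Icc, mem_filter, Nat.mem_divisors]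
    constructor
    · rintro ⟨⟨hx1, hxR⟩, hnx, hx0⟩
      have hn1 : 1 ≤ n := Nat.pos_of_dvd_of_pos hnx (by omega)
      exact ⟨⟨⟨hx1, hxR⟩, hnx⟩, hn1, (Nat.le_of_dvd (by omega) hnx).trans hxR⟩
    · rintro ⟨⟨⟨hx1, hxR⟩, hnx⟩, hn1, hnR⟩
      exact ⟨⟨hx1, hxR⟩, hnx, by omega⟩
  -- Step 2: multiples x = n * m
  have h2 : ∀ n ∈ Icc 1 R, ∑ x ∈ (Icc 1 R).filter (fun x => n ∣ x), h x n =
      ∑ m ∈ Icc 1 (R / n), h (n * m) n := by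
    intro n hn
    exact sum_Icc_filter_dvd_eq_mul' (mem_Icc.1 hn).1 (fun x => h x n)
  rw [h1, Finset.sum_congr rfl h2]
  -- Step 3: swap (n, m) ↦ (m, n) over the region n m ≤ R
  have h3 : ∑ n ∈ Icc 1 R, ∑ m ∈ Icc 1 (R / n), h (n * m) n =
      ∑ m ∈ Icc 1 R, ∑ n ∈ Icc 1 (R / m), h (n * m) n := by
    refine Finset.sum_comm' ?_
    intro n m
    simp only [mem_Icc]
    constructor
    · rintro ⟨⟨hn1, hnR⟩, hm1, hmR⟩
      have hnm : m * n ≤ R := (Nat.le_div_iff_mul_le (by omega)).1 hmR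
      refine ⟨⟨hn1, ?_⟩, hm1, le_trans (Nat.le_mul_of_pos_right m (by omega)) hnm⟩
      exact (Nat.le_div_iff_mul_le (by omega)).2 (by rw [mul_comm]; exact hnm)
    · rintro ⟨⟨hn1, hnR⟩, hm1, hmR⟩
      have hnm : n * m ≤ R := (Nat.le_div_iff_mul_le (by omega)).1 hnR
      refine ⟨⟨hn1, le_trans (Nat.le_mul_of_pos_right n (by omega)) hnm⟩, hm1, ?_⟩
      exact (Nat.le_div_iff_mul_le (by omega)).2 (by rw [mul_comm]; exact hnm)
  rw [h3]
  exact Finset.sum_congr rfl fun m _ => Finset.sum_congr rfl fun n _ => by rw [mul_comm]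

/-! ### The divergence identity -/

/-- **`div F = σ_W − ν_exit` (unnormalised).**  For every `g : ℕ → ℝ` and `1 ≤ Q`:
`Σ_{x ≤ R} Σ_{n ∣ x} (Γ(x)/x)(Λ(n)/log x)(g(x) − g(x/n)) = Σ_{Q<x≤R} g(x)/x − Σ_{b ≤ Q} ν_exit(b)·g(b)`. -/
theorem exit_flow_divergence {R Q : ℕ} (hQ : 1 ≤ Q) (hQR : Q ≤ R) (g : ℕ → ℝ) :
    ∑ x ∈ Icc 1 R, ∑ n ∈ x.divisors,
        exitGamma R Q x / x * (vonMangoldt n / Real.log x) * (g x - g (x / n)) =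
      ∑ x ∈ Ioc Q R, g x / x - ∑ b ∈ Icc 1 Q, exitInflow R Q b * g b := by
  -- out-part: Σ_{n ∣ x} Λ(n) = log x
  have hout : ∀ x ∈ Icc 1 R, ∑ n ∈ x.divisors, exitGamma R Q x / x * (vonMangoldt n / Real.log x) * g x =
      exitGamma R Q x / x * g x := by
    intro x hx
    by_cases hW : Q < x ∧ x ≤ R
    · have hx2 : (2 : ℝ) ≤ x := by exact_mod_cast (show 2 ≤ x by omega)
      have hlog : Real.log x ≠ 0 := (Real.log_pos (by linarith)).ne'
      rw [← Finset.sum_mul, ← Finset.mul_sum, ← Finset.sum_div, ArithmeticFunction.vonMangoldt_sum,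
        div_self hlog, mul_one]
    · simp [exitGamma_of_not_mem hW]
  -- in-part: reindex x = y n
  have hin : ∑ x ∈ Icc 1 R, ∑ n ∈ x.divisors, exitGamma R Q x / x * (vonMangoldt n / Real.log x) * g (x / n) =
      ∑ y ∈ Icc 1 R, exitInflow R Q y * g y := by
    rw [sum_divisors_reindex R (fun x n => exitGamma R Q x / x * (vonMangoldt n / Real.log x) * g (x / n))]
    refine Finset.sum_congr rfl fun y hy => ?_
    have hy0 : y ≠ 0 := by have := (mem_Icc.1 hy).1; omega
    unfold exitInflow
    rw [Finset.sum_mul]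
    refine Finset.sum_congr rfl fun n hn => ?_
    have hn0 : n ≠ 0 := by have := (mem_Icc.1 hn).1; omega
    rw [Nat.mul_div_cancel _ (Nat.pos_of_ne_zero hn0)]
  have hsplit : ∀ x ∈ Icc 1 R, ∑ n ∈ x.divisors,
      exitGamma R Q x / x * (vonMangoldt n / Real.log x) * (g x - g (x / n)) =
      ∑ n ∈ x.divisors, exitGamma R Q x / x * (vonMangoldt n / Real.log x) * g x -
        ∑ n ∈ x.divisors, exitGamma R Q x / x * (vonMangoldt n / Real.log x) * g (x / n) := by
    intro x _
    rw [← Finset.sum_sub_distrib]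
    exact Finset.sum_congr rfl fun n _ => by ring
  rw [Finset.sum_congr rfl hsplit, Finset.sum_sub_distrib, Finset.sum_congr rfl hout, hin]
  -- Σ_{x ≤ R} Γ g/x = Σ_W Γ g/x (Γ = 0 off W); Σ_{y ≤ R} inflow·g = Σ_W (Γ/y − 1/y) g + Σ_{y ≤ Q} ν_exit g
  have hIcc : Icc 1 R = Icc 1 Q ∪ Ioc Q R := by
    ext x; simp only [Finset.mem_union, Finset.mem_Icc, Finset.mem_Ioc]; omega
  have hdisj : Disjoint (Icc 1 Q) (Ioc Q R) := by
    rw [Finset.disjoint_left]; intro x hx hx'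
    simp only [Finset.mem_Icc] at hx; simp only [Finset.mem_Ioc] at hx'; omega
  rw [hIcc, Finset.sum_union hdisj, Finset.sum_union hdisj]
  have hB : ∑ x ∈ Icc 1 Q, exitGamma R Q x / x * g x = 0 := by
    refine Finset.sum_eq_zero fun x hx => ?_
    have : ¬(Q < x ∧ x ≤ R) := by simp only [Finset.mem_Icc] at hx; omega
    simp [exitGamma_of_not_mem this]
  have hWin : ∑ x ∈ Ioc Q R, exitInflow R Q x * g x = ∑ x ∈ Ioc Q R, (exitGamma R Q x / x - 1 / x) * g x := by
    refine Finset.sum_congr rfl fun x hx => ?_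
    rw [exitInflow_eq_of_mem (by simp only [Finset.mem_Ioc] at hx; exact ⟨hx.1, hx.2⟩)]
  rw [hB, hWin]
  have hexp : ∑ x ∈ Ioc Q R, (exitGamma R Q x / x - 1 / x) * g x =
      ∑ x ∈ Ioc Q R, exitGamma R Q x / x * g x - ∑ x ∈ Ioc Q R, g x / x := by
    rw [← Finset.sum_sub_distrib]; exact Finset.sum_congr rfl fun x _ => by ring
  rw [hexp]
  ring

/-- **Conservation**: the exit measure has the (unnormalised) mass of the window,
`Σ_{b ≤ Q} ν_exit(b) = Σ_{Q<x≤R} 1/x`. -/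
theorem sum_exitInflow_eq {R Q : ℕ} (hQ : 1 ≤ Q) (hQR : Q ≤ R) :
    ∑ b ∈ Icc 1 Q, exitInflow R Q b = ∑ x ∈ Ioc Q R, (1 : ℝ) / x := by
  have h := exit_flow_divergence hQ hQR (fun _ => (1 : ℝ))
  simp only [sub_self, mul_zero, Finset.sum_const_zero, mul_one] at h
  linarith

/-! ### The flow form of Cauchy–Schwarz -/

/-- **Thomson / Cauchy–Schwarz for the exit-death flow.**  For every `g : ℕ → ℝ`, `1 ≤ Q ≤ R`:
`(Σ_{Q<x≤R} g(x)/x − Σ_{b≤Q} ν_exit(b)g(b))² ≤ [Σ_{Q<x≤R} Γ(x)²/(x log x)] · Σ_{x≤R}(1/x)Σ_{n∣x}Λ(n)(g(x) − g(x/n))²`. -/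
theorem exit_flow_cauchy_schwarz {R Q : ℕ} (hQ : 1 ≤ Q) (hQR : Q ≤ R) (g : ℕ → ℝ) :
    (∑ x ∈ Ioc Q R, g x / x - ∑ b ∈ Icc 1 Q, exitInflow R Q b * g b) ^ 2 ≤
      (∑ x ∈ Ioc Q R, exitGamma R Q x ^ 2 / (x * Real.log x)) *
        ∑ x ∈ Icc 1 R, (1 / (x : ℝ)) * ∑ n ∈ x.divisors, vonMangoldt n * (g x - g (x / n)) ^ 2 := by
  rw [← exit_flow_divergence hQ hQR g]
  -- flatten the double sums over the sigma-type of divisor pairs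
  set S := (Icc 1 R).sigma fun x => x.divisors with hS
  have hflat : ∑ x ∈ Icc 1 R, ∑ n ∈ x.divisors,
      exitGamma R Q x / x * (vonMangoldt n / Real.log x) * (g x - g (x / n)) =
      ∑ p ∈ S, exitGamma R Q p.1 / p.1 * (vonMangoldt p.2 / Real.log p.1) * (g p.1 - g (p.1 / p.2)) := by
    rw [Finset.sum_sigma]
  have hE : ∑ p ∈ S, (1 / (p.1 : ℝ)) * vonMangoldt p.2 * (exitGamma R Q p.1 / Real.log p.1) ^ 2 =
      ∑ x ∈ Ioc Q R, exitGamma R Q x ^ 2 / (x * Real.log x) := by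
    rw [hS, Finset.sum_sigma]
    -- inner: Σ_{n ∣ x} Λ(n) = log x
    have hIcc : Icc 1 R = Icc 1 Q ∪ Ioc Q R := by
      ext x; simp only [Finset.mem_union, Finset.mem_Icc, Finset.mem_Ioc]; omega
    have hdisj : Disjoint (Icc 1 Q) (Ioc Q R) := by
      rw [Finset.disjoint_left]; intro x hx hx'
      simp only [Finset.mem_Icc] at hx; simp only [Finset.mem_Ioc] at hx'; omega
    rw [hIcc, Finset.sum_union hdisj]
    have hB : ∑ x ∈ Icc 1 Q, ∑ n ∈ x.divisors,
        (1 / (x : ℝ)) * vonMangoldt n * (exitGamma R Q x / Real.log x) ^ 2 = 0 := by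
      refine Finset.sum_eq_zero fun x hx => ?_
      have : ¬(Q < x ∧ x ≤ R) := by simp only [Finset.mem_Icc] at hx; omega
      simp [exitGamma_of_not_mem this]
    rw [hB, zero_add]
    refine Finset.sum_congr rfl fun x hx => ?_
    have hx' := Finset.mem_Ioc.1 hx
    have hx2 : (2 : ℝ) ≤ x := by exact_mod_cast (show 2 ≤ x by omega)
    have hlog : Real.log x ≠ 0 := (Real.log_pos (by linarith)).ne'
    have hx0 : (x : ℝ) ≠ 0 := by positivity
    have : ∑ n ∈ x.divisors, (1 / (x : ℝ)) * vonMangoldt n * (exitGamma R Q x / Real.log x) ^ 2 =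
        (1 / (x : ℝ)) * (exitGamma R Q x / Real.log x) ^ 2 * ∑ n ∈ x.divisors, vonMangoldt n := by
      rw [Finset.mul_sum]; exact Finset.sum_congr rfl fun n _ => by ring
    rw [this, ArithmeticFunction.vonMangoldt_sum]
    field_simp
  have hD : ∑ p ∈ S, (1 / (p.1 : ℝ)) * vonMangoldt p.2 * (g p.1 - g (p.1 / p.2)) ^ 2 =
      ∑ x ∈ Icc 1 R, (1 / (x : ℝ)) * ∑ n ∈ x.divisors, vonMangoldt n * (g x - g (x / n)) ^ 2 := by
    rw [hS, Finset.sum_sigma]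
    refine Finset.sum_congr rfl fun x _ => ?_
    rw [Finset.mul_sum]; exact Finset.sum_congr rfl fun n _ => by ring
  rw [hflat, ← hE, ← hD]
  refine Finset.sum_sq_le_sum_mul_sum_of_sq_le_mul S (fun p _ => ?_) (fun p _ => ?_) (fun p hp => le_of_eq ?_)
  · exact mul_nonneg (mul_nonneg (by positivity) ArithmeticFunction.vonMangoldt_nonneg) (sq_nonneg _)
  · exact mul_nonneg (mul_nonneg (by positivity) ArithmeticFunction.vonMangoldt_nonneg) (sq_nonneg _)
  · ring

/-- **The `κ_F` half of THEOREM A as a kernel inequality** (CONTINUUM-LIMIT §25.4–25.5): for `2 ≤ Q ≤ R`,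
the pointwise Green bound `Γ(x) ≤ A log R/log x` on the window, and every `g`:
`(Σ_{Q<x≤R} g(x)/x − Σ_{b≤Q} ν_exit(b)g(b))² ≤ A² log²R·(1/(2log²Q) − 1/(2log²R)) · D(g)`. -/
theorem exit_flow_cauchy_schwarz_explicit {R Q : ℕ} (hQ : 2 ≤ Q) (hQR : Q ≤ R) {A : ℝ}
    (hΓU : ∀ x, Q < x → x ≤ R → exitGamma R Q x ≤ A * Real.log R / Real.log x) (g : ℕ → ℝ) :
    (∑ x ∈ Ioc Q R, g x / x - ∑ b ∈ Icc 1 Q, exitInflow R Q b * g b) ^ 2 ≤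
      A ^ 2 * Real.log R ^ 2 * (1 / (2 * Real.log Q ^ 2) - 1 / (2 * Real.log R ^ 2)) *
        ∑ x ∈ Icc 1 R, (1 / (x : ℝ)) * ∑ n ∈ x.divisors, vonMangoldt n * (g x - g (x / n)) ^ 2 := by
  have h1 := exit_flow_cauchy_schwarz (by omega) hQR g
  have h2 := sum_exitGamma_sq_div_le hQ hQR hΓU
  have hD : 0 ≤ ∑ x ∈ Icc 1 R, (1 / (x : ℝ)) * ∑ n ∈ x.divisors, vonMangoldt n * (g x - g (x / n)) ^ 2 :=
    Finset.sum_nonneg fun x _ => mul_nonneg (by positivity)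
      (Finset.sum_nonneg fun n _ => mul_nonneg ArithmeticFunction.vonMangoldt_nonneg (sq_nonneg _))
  exact h1.trans (mul_le_mul_of_nonneg_right h2 hD)

end Summit.RiemannHypothesis.RiemannHypothesis.Theorems.IntegerScrew

end
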